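import Literature.Barriers.CriticalPhenomena.HaraGaussianLemmaLatticeSums
import Mathlib.Algebra.Order.Ring.Pow
import HarnessLib

/-!
# Hara's Lemma B.1 (i), (iii): decay of lattice convolutions

Support file for the decomposition of the named fact `Hara2008_gaussianConvolution`
(`LaceExpansionXSpaceAsymptotics.lean`; Hara 2008, Cor. 1.4). Hara 2008, Appendix B, Lemma B.1
collects the "basic properties of convolution" used in the proof of the Gaussian lemma: parts
(i)–(ii) are Prop. 1.7 of Hara–van der Hofstad–Slade 2003, parts (iii)–(iv) are proved in
Appendix B. This file PROVES

* `exists_convolution_bound_i` — Lemma B.1 (i) in the case `α > d > β ≥ 0`: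
  `|f| ≤ A⟦·⟧^{-α}`, `|g| ≤ B⟦·⟧^{-β}` ⇒ `|(f*g)(x)| ≤ C A B ⟦x⟧^{-β}` (the case of (i) used by
  Lemma B.1 (ii), hence by Cor. 1.4);
* `exists_convolution_bound_iii` — Lemma B.1 (iii): `|f| ≤ A⟦·⟧^{-α}` (`0 < α < d`),
  `Σ|g| ≤ K`, `|g| ≤ K⟦·⟧^{-d}` ⇒ `|(f*g)(x)| ≤ C A K ⟦x⟧^{-α}` (the input of Hara's Lemma 2.3);
* the elementary real inequality behind part (ii) (`HaraGaussianLemmaConvolutionMain.lean`):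
  the symmetric second difference of `u ↦ u^{-m}`,
  `|a^{-m} + b^{-m} - 2r^{-m}| ≤ m(m+1)4^{m+1} t² r^{-(m+2)}` for `a = |x-y|`, `b = |x+y|`,
  `r = |x|`, `t = |y| ≤ r/2` (`abs_symm_second_diff_inv_pow_le`, from Bernoulli's inequality —
  no calculus).

Convolutions are written out as lattice sums `Σ_y f(x-y) g(y)` (Hara's `(f*g)(x)`, §1.1) resp.
`Σ_y f(y) g(x-y)`; constants depend on `d` and the exponents only. The case `α, β < d` of (i) and
part (iv) (the `∼` version) are not needed for Cor. 1.4 and are not treated.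

## References

* T. Hara, Ann. Probab. 36 (2008) 530–593, Appendix B, Lemma B.1 (i)–(iv) and the proof of
  (iii) ("Divide the sum defining `f*g` into two, `T₁ = Σ_{|y|<|x|/2}`, `T₂ = Σ_{|y| ≥ |x|/2}` …").
* T. Hara, R. van der Hofstad, G. Slade, Ann. Probab. 31 (2003) 349–408, Prop. 1.7 (i) and its
  proof (§5).
-/

noncomputable section

namespace Literature.Barriers.CriticalPhenomena

open MeasureTheory Finset Literature.Probability.LatticeModels

variable {d : ℕ}

/-! ### The symmetric second difference of `u ↦ u^{-m}` -/
/-- Bernoulli in product form: `u^m ((m+1) v - m u) ≤ v^{m+1}` for `u, v > 0`. [folklore] -/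
theorem pow_mul_sub_le_pow_succ (m : ℕ) {u v : ℝ} (hu : 0 < u) (hv : 0 < v) :
    u ^ m * ((m + 1) * v - m * u) ≤ v ^ (m + 1) := by
  have hB := one_add_mul_le_pow (a := v / u - 1) (by
    have : 0 < v / u := div_pos hv hu
    linarith) (m + 1)
  have h1 : (1 + (v / u - 1)) ^ (m + 1) = v ^ (m + 1) / u ^ (m + 1) := by
    rw [add_sub_cancel, div_pow]
  rw [h1, le_div_iff₀ (pow_pos hu _)] at hB
  push_cast at hB
  have h2 : (1 + (m + 1) * (v / u - 1)) * u ^ (m + 1) = u ^ m * ((m + 1) * v - m * u) := by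
    field_simp
    ring
  linarith

/-- Tangent inequality for `u ↦ u^{-m}` (convexity): `v^{-m} - u^{-m} ≤ m (u - v) v^{-(m+1)}` for
`u, v > 0`. [folklore] -/
theorem inv_pow_sub_inv_pow_le (m : ℕ) {u v : ℝ} (hu : 0 < u) (hv : 0 < v) :
    (v ^ m)⁻¹ - (u ^ m)⁻¹ ≤ m * (u - v) / v ^ (m + 1) := by
  have key := pow_mul_sub_le_pow_succ m hu hv
  have hum : 0 < u ^ m := pow_pos hu m
  have hvm : 0 < v ^ m := pow_pos hv m
  have hvm1 : 0 < v ^ (m + 1) := pow_pos hv (m + 1)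
  rw [inv_eq_one_div, inv_eq_one_div, div_sub_div _ _ hvm.ne' hum.ne', div_le_div_iff₀ (mul_pos hvm hum) hvm1]
  have key' := mul_le_mul_of_nonneg_left key hvm.le
  have e1 : v ^ (m + 1) = v ^ m * v := pow_succ v m
  rw [e1] at key' ⊢
  nlinarith [key', hvm, hum]


/-- The second-order defect `D(a) = a^{-m} - r^{-m} + m r^{-(m+1)} (a - r)` of `u ↦ u^{-m}` at `r`
is nonnegative. [folklore] -/
theorem inv_pow_defect_nonneg (m : ℕ) {a r : ℝ} (ha : 0 < a) (hr : 0 < r) :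
    0 ≤ (a ^ m)⁻¹ - (r ^ m)⁻¹ + m * (a - r) / r ^ (m + 1) := by
  have := inv_pow_sub_inv_pow_le m ha hr
  linarith

/-- … and at most `m (a - r) (r^{-(m+1)} - a^{-(m+1)})`. [folklore] -/
theorem inv_pow_defect_le (m : ℕ) {a r : ℝ} (ha : 0 < a) (hr : 0 < r) :
    (a ^ m)⁻¹ - (r ^ m)⁻¹ + m * (a - r) / r ^ (m + 1) ≤ m * (a - r) * ((r ^ (m + 1))⁻¹ - (a ^ (m + 1))⁻¹) := by
  have := inv_pow_sub_inv_pow_le m hr ha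
  have e : m * (a - r) * ((r ^ (m + 1))⁻¹ - (a ^ (m + 1))⁻¹) =
      m * (a - r) / r ^ (m + 1) + m * (r - a) / a ^ (m + 1) := by ring
  rw [e]
  linarith

/-- `|r^{-(m+1)} - a^{-(m+1)}| ≤ (m+1) 2^{2m+1} |a - r| r^{-(m+2)}` for `r/2 ≤ a ≤ 2r`. [folklore] -/
theorem abs_inv_pow_sub_inv_pow_le (m : ℕ) {a r : ℝ} (hr : 0 < r) (ha1 : r / 2 ≤ a) (ha2 : a ≤ 2 * r) :
    |(r ^ (m + 1))⁻¹ - (a ^ (m + 1))⁻¹| ≤ (m + 1) * 2 ^ (2 * m + 1) * |a - r| / r ^ (m + 2) := by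
  have ha : 0 < a := by linarith
  have hrm : 0 < r ^ (m + 1) := pow_pos hr _
  have ham : 0 < a ^ (m + 1) := pow_pos ha _
  have hsub : (r ^ (m + 1))⁻¹ - (a ^ (m + 1))⁻¹ = (a ^ (m + 1) - r ^ (m + 1)) / (r ^ (m + 1) * a ^ (m + 1)) := by
    field_simp
  rw [hsub, abs_div, abs_of_pos (mul_pos hrm ham)]
  have hpow := abs_pow_sub_pow_le a r (m + 1)
  rw [Nat.add_sub_cancel, abs_of_pos ha, abs_of_pos hr] at hpow
  have hmax : max a r ≤ 2 * r := max_le ha2 (by linarith)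
  have hmax0 : 0 ≤ max a r := ha.le.trans (le_max_left _ _)
  have h1 : |a ^ (m + 1) - r ^ (m + 1)| ≤ |a - r| * (m + 1) * (2 * r) ^ m := by
    calc _ ≤ |a - r| * ↑(m + 1) * max a r ^ m := hpow
      _ ≤ |a - r| * ↑(m + 1) * (2 * r) ^ m := by
          push_cast
          gcongr
      _ = _ := by norm_cast
  -- lower bound on the denominator: `r^{m+1} a^{m+1} ≥ r^{m+1} (r/2)^{m+1}`
  have h2 : r ^ (m + 1) * (r / 2) ^ (m + 1) ≤ r ^ (m + 1) * a ^ (m + 1) :=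
    mul_le_mul_of_nonneg_left (pow_le_pow_left₀ (by linarith) ha1 _) hrm.le
  have h3 : 0 < r ^ (m + 1) * (r / 2) ^ (m + 1) := by positivity
  calc |a ^ (m + 1) - r ^ (m + 1)| / (r ^ (m + 1) * a ^ (m + 1))
      ≤ |a - r| * (m + 1) * (2 * r) ^ m / (r ^ (m + 1) * (r / 2) ^ (m + 1)) := by
        gcongr
    _ = (m + 1) * 2 ^ (2 * m + 1) * |a - r| / r ^ (m + 2) := by
        rw [div_pow, mul_pow]
        field_simp
        ring


/-- **Symmetric second difference of `u ↦ u^{-m}`.** If `r > 0`, `0 ≤ t ≤ r/2`, `|a - r| ≤ t`,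
`|b - r| ≤ t`, `a + b ≥ 2r` and `a² + b² ≤ 2r² + 2t²` (as for `a = |x - y|`, `b = |x + y|`,
`r = |x|`, `t = |y|`), then `|a^{-m} + b^{-m} - 2 r^{-m}| ≤ m (m+1) 4^{m+1} t² r^{-(m+2)}`.
[folklore] -/
theorem abs_symm_second_diff_inv_pow_le (m : ℕ) {r a b t : ℝ} (hr : 0 < r) (ht : 0 ≤ t)
    (htr : t ≤ r / 2) (har : |a - r| ≤ t) (hbr : |b - r| ≤ t) (hab : 2 * r ≤ a + b)
    (hpar : a ^ 2 + b ^ 2 ≤ 2 * r ^ 2 + 2 * t ^ 2) :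
    |(a ^ m)⁻¹ + (b ^ m)⁻¹ - 2 * (r ^ m)⁻¹| ≤ m * (m + 1) * 4 ^ (m + 1) * t ^ 2 / r ^ (m + 2) := by
  have har' := abs_le.1 har
  have hbr' := abs_le.1 hbr
  have ha1 : r / 2 ≤ a := by linarith
  have ha2 : a ≤ 2 * r := by linarith
  have hb1 : r / 2 ≤ b := by linarith
  have hb2 : b ≤ 2 * r := by linarith
  have ha : 0 < a := by linarith
  have hb : 0 < b := by linarith
  have hrm2 : 0 < r ^ (m + 2) := pow_pos hr _
  have hrm1 : 0 < r ^ (m + 1) := pow_pos hr _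
  -- the defects `D(a), D(b) ∈ [0, m (m+1) 2^{2m+1} t² / r^{m+2}]`
  set Da := (a ^ m)⁻¹ - (r ^ m)⁻¹ + m * (a - r) / r ^ (m + 1) with hDa
  set Db := (b ^ m)⁻¹ - (r ^ m)⁻¹ + m * (b - r) / r ^ (m + 1) with hDb
  have hDa0 : 0 ≤ Da := inv_pow_defect_nonneg m ha hr
  have hDb0 : 0 ≤ Db := inv_pow_defect_nonneg m hb hr
  have hbound : ∀ {c : ℝ}, 0 < c → r / 2 ≤ c → c ≤ 2 * r → |c - r| ≤ t →
      (c ^ m)⁻¹ - (r ^ m)⁻¹ + m * (c - r) / r ^ (m + 1) ≤ m * (m + 1) * 2 ^ (2 * m + 1) * t ^ 2 / r ^ (m + 2) := by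
    intro c hc hc1 hc2 hcr
    have h1 := inv_pow_defect_le m hc hr
    have h2 := abs_inv_pow_sub_inv_pow_le m hr hc1 hc2
    have h3 : m * (c - r) * ((r ^ (m + 1))⁻¹ - (c ^ (m + 1))⁻¹) ≤
        m * |c - r| * ((m + 1) * 2 ^ (2 * m + 1) * |c - r| / r ^ (m + 2)) := by
      calc m * (c - r) * ((r ^ (m + 1))⁻¹ - (c ^ (m + 1))⁻¹)
          ≤ |m * (c - r) * ((r ^ (m + 1))⁻¹ - (c ^ (m + 1))⁻¹)| := le_abs_self _
        _ = m * |c - r| * |(r ^ (m + 1))⁻¹ - (c ^ (m + 1))⁻¹| := by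
            rw [abs_mul, abs_mul, Nat.abs_cast]
        _ ≤ m * |c - r| * ((m + 1) * 2 ^ (2 * m + 1) * |c - r| / r ^ (m + 2)) := by
            gcongr
    have h4 : m * |c - r| * ((m + 1) * 2 ^ (2 * m + 1) * |c - r| / r ^ (m + 2)) ≤
        m * (m + 1) * 2 ^ (2 * m + 1) * t ^ 2 / r ^ (m + 2) := by
      have hcr0 : 0 ≤ |c - r| := abs_nonneg _
      have h5 : |c - r| * |c - r| ≤ t * t := mul_le_mul hcr hcr hcr0 ht
      rw [mul_div_assoc, mul_div_assoc]
      have : 0 ≤ (m : ℝ) * (m + 1) * 2 ^ (2 * m + 1) / r ^ (m + 2) := by positivity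
      calc (m : ℝ) * |c - r| * ((m + 1) * 2 ^ (2 * m + 1) * (|c - r| / r ^ (m + 2)))
          = (m : ℝ) * (m + 1) * 2 ^ (2 * m + 1) / r ^ (m + 2) * (|c - r| * |c - r|) := by ring
        _ ≤ (m : ℝ) * (m + 1) * 2 ^ (2 * m + 1) / r ^ (m + 2) * (t * t) := by gcongr
        _ = (m : ℝ) * (m + 1) * 2 ^ (2 * m + 1) * (t ^ 2 / r ^ (m + 2)) := by ring
    linarith
  have hDa1 : Da ≤ m * (m + 1) * 2 ^ (2 * m + 1) * t ^ 2 / r ^ (m + 2) := hbound ha ha1 ha2 har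
  have hDb1 : Db ≤ m * (m + 1) * 2 ^ (2 * m + 1) * t ^ 2 / r ^ (m + 2) := hbound hb hb1 hb2 hbr
  -- `0 ≤ a + b - 2r ≤ t²/r`
  have hsum1 : a + b - 2 * r ≤ t ^ 2 / r := by
    have h1 : (a + b) ^ 2 ≤ (2 * r + t ^ 2 / r) ^ 2 := by
      have e : (2 * r + t ^ 2 / r) ^ 2 = 4 * r ^ 2 + 4 * t ^ 2 + (t ^ 2 / r) ^ 2 := by
        field_simp
        ring
      rw [e]
      nlinarith [sq_nonneg (a - b), sq_nonneg (t ^ 2 / r)]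
    have h2 : 0 ≤ 2 * r + t ^ 2 / r := by positivity
    have h3 : 0 ≤ a + b := by linarith
    have h4 := (sq_le_sq₀ h3 h2).1 h1
    linarith
  -- assemble
  have hS : (a ^ m)⁻¹ + (b ^ m)⁻¹ - 2 * (r ^ m)⁻¹ = Da + Db - m * (a + b - 2 * r) / r ^ (m + 1) := by
    simp only [hDa, hDb]
    ring
  rw [hS, abs_le]
  have hlow : m * (a + b - 2 * r) / r ^ (m + 1) ≤ m * (t ^ 2 / r) / r ^ (m + 1) := by
    gcongr
  have hlow' : (m : ℝ) * (t ^ 2 / r) / r ^ (m + 1) = m * t ^ 2 / r ^ (m + 2) := by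
    field_simp
    ring
  have hpos : 0 ≤ m * (a + b - 2 * r) / r ^ (m + 1) := by
    have : 0 ≤ a + b - 2 * r := by linarith
    positivity
  have hm1 : (m : ℝ) * t ^ 2 / r ^ (m + 2) ≤ m * (m + 1) * 4 ^ (m + 1) * t ^ 2 / r ^ (m + 2) := by
    have h1 : 0 ≤ (m : ℝ) * t ^ 2 / r ^ (m + 2) := by positivity
    have h2 : (1 : ℝ) ≤ (m + 1) * 4 ^ (m + 1) := by
      have : (1 : ℝ) ≤ 4 ^ (m + 1) := one_le_pow₀ (by norm_num)
      nlinarith [(Nat.cast_nonneg m : (0 : ℝ) ≤ m)]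
    calc (m : ℝ) * t ^ 2 / r ^ (m + 2) = 1 * ((m : ℝ) * t ^ 2 / r ^ (m + 2)) := by ring
      _ ≤ ((m + 1) * 4 ^ (m + 1)) * ((m : ℝ) * t ^ 2 / r ^ (m + 2)) := mul_le_mul_of_nonneg_right h2 h1
      _ = _ := by ring
  have hm2 : 2 * (m * (m + 1) * 2 ^ (2 * m + 1) * t ^ 2 / r ^ (m + 2)) =
      m * (m + 1) * 4 ^ (m + 1) * t ^ 2 / r ^ (m + 2) := by
    rw [show (4 : ℝ) ^ (m + 1) = 2 ^ (2 * m + 1) * 2 by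
      rw [show (4 : ℝ) = 2 ^ 2 by norm_num, ← pow_mul, ← pow_succ]; ring_nf]
    ring
  constructor
  · linarith
  · linarith


/-! ### Hara's Lemma B.1 (iii) -/

/-- **Hara 2008, Lemma B.1 (iii).** Let `0 < α < d`. There is a constant `C = C(α, d)` such that
for all functions `f, g` on `ℤ^d` with `|f(x)| ≤ A ⟦x⟧^{-α}`, `Σ_x |g(x)| ≤ K` and
`|g(x)| ≤ K ⟦x⟧^{-d}`, the convolution obeys `|(f*g)(x)| ≤ C A K ⟦x⟧^{-α}` (printed with `A = 1`
and `|x|` in place of `⟦x⟧` for `x ≠ 0`; split the sum at `|y| = |x|/2`).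
[cite: Hara2008, Lemma B.1 (iii) and its proof (Appendix B)] -/
theorem exists_convolution_bound_iii (hd : 1 ≤ d) {α : ℝ} (hα0 : 0 < α) (hαd : α < d) :
    ∃ C : ℝ, 0 ≤ C ∧ ∀ (f g : Site d → ℝ) (A K : ℝ), (∀ y, |f y| ≤ A * jnorm y ^ (-α)) →
      Summable (fun y => |g y|) → ∑' y, |g y| ≤ K → (∀ y, |g y| ≤ K * jnorm y ^ (-(d : ℝ))) →
      ∀ x, |∑' y, f y * g (x - y)| ≤ C * A * K * jnorm x ^ (-α) := by
  obtain ⟨Cb, hCb, hball⟩ := exists_tsum_ball_jnorm_rpow_neg_le hd hα0.le hαd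
  refine ⟨2 ^ (d : ℝ) * Cb + 2 ^ α, by positivity, fun f g A K hf hg hgK hgd x => ?_⟩
  have hA : 0 ≤ A := nonneg_of_decay hf
  have hK : 0 ≤ K := (tsum_nonneg fun y => abs_nonneg (g y)).trans hgK
  have hx := jnorm_pos x
  set F : Site d → ℝ := fun y => f y * g (x - y) with hF_def
  have hgx : Summable fun y => |g (x - y)| := summable_comp_sub_left hg x
  have hFs : Summable F := by
    refine Summable.of_norm_bounded (hgx.mul_left A) fun y => ?_
    rw [Real.norm_eq_abs, hF_def, abs_mul]
    have h1 : |f y| ≤ A := (hf y).trans (mul_le_of_le_one_right hA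
      (Real.rpow_le_one_of_one_le_of_nonpos (one_le_jnorm y) (by linarith)))
    exact mul_le_mul_of_nonneg_right h1 (abs_nonneg _)
  set s : Set (Site d) := {y | euclidNorm y ≤ euclidNorm x / 2} with hs_def
  rw [tsum_eq_tsum_indicator_add_compl hFs s]
  -- inner region `|y| ≤ |x|/2`: there `⟦x - y⟧ ≥ ⟦x⟧/2`
  have hT₁ : |∑' y, s.indicator F y| ≤ 2 ^ (d : ℝ) * Cb * A * K * jnorm x ^ (-α) := by
    have hG : Summable (s.indicator fun y => A * K * 2 ^ (d : ℝ) * jnorm x ^ (-(d : ℝ)) * jnorm y ^ (-α)) :=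
      summable_indicator_ball _ _
    refine (abs_tsum_indicator_le hFs hG fun y hy => ?_).trans ?_
    · have hy' : euclidNorm y ≤ euclidNorm x / 2 := hy
      have hxy : jnorm x ≤ 2 * jnorm (x - y) :=
        jnorm_le_mul_jnorm (by norm_num) (by linarith [euclidNorm_le_sub_add x y])
      have h1 := jnorm_rpow_neg_le_of_jnorm_le (by norm_num) (Nat.cast_nonneg d) hxy
      rw [hF_def, abs_mul]
      have hAy : 0 ≤ A * jnorm y ^ (-α) := mul_nonneg hA (Real.rpow_nonneg (jnorm_pos y).le _)
      calc |f y| * |g (x - y)| ≤ (A * jnorm y ^ (-α)) * (K * jnorm (x - y) ^ (-(d : ℝ))) :=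
            mul_le_mul (hf y) (hgd _) (abs_nonneg _) hAy
        _ ≤ (A * jnorm y ^ (-α)) * (K * (2 ^ (d : ℝ) * jnorm x ^ (-(d : ℝ)))) :=
            mul_le_mul_of_nonneg_left (mul_le_mul_of_nonneg_left h1 hK) hAy
        _ = A * K * 2 ^ (d : ℝ) * jnorm x ^ (-(d : ℝ)) * jnorm y ^ (-α) := by ring
    · have e : (s.indicator fun y => A * K * 2 ^ (d : ℝ) * jnorm x ^ (-(d : ℝ)) * jnorm y ^ (-α)) =
          fun y => A * K * 2 ^ (d : ℝ) * jnorm x ^ (-(d : ℝ)) * s.indicator (fun y => jnorm y ^ (-α)) y := by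
        funext y
        exact Set.indicator_mul_right s (fun _ => A * K * 2 ^ (d : ℝ) * jnorm x ^ (-(d : ℝ))) _
      rw [e, tsum_mul_left]
      have h2 := hball (euclidNorm x / 2)
      have h3 : (max (euclidNorm x / 2) 1) ^ ((d : ℝ) - α) ≤ jnorm x ^ ((d : ℝ) - α) :=
        max_div_one_rpow_le x (by norm_num) (by linarith)
      calc A * K * 2 ^ (d : ℝ) * jnorm x ^ (-(d : ℝ)) * ∑' y, s.indicator (fun y => jnorm y ^ (-α)) y
          ≤ A * K * 2 ^ (d : ℝ) * jnorm x ^ (-(d : ℝ)) * (Cb * jnorm x ^ ((d : ℝ) - α)) :=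
            mul_le_mul_of_nonneg_left (h2.trans (mul_le_mul_of_nonneg_left h3 hCb))
              (mul_nonneg (by positivity) (Real.rpow_nonneg hx.le _))
        _ = 2 ^ (d : ℝ) * Cb * A * K * (jnorm x ^ (-(d : ℝ)) * jnorm x ^ ((d : ℝ) - α)) := by ring
        _ = 2 ^ (d : ℝ) * Cb * A * K * jnorm x ^ (-α) := by
            rw [jnorm_rpow_mul_rpow]; ring_nf
  -- outer region `|y| > |x|/2`: there `⟦y⟧ ≥ ⟦x⟧/2`
  have hT₂ : |∑' y, sᶜ.indicator F y| ≤ 2 ^ α * A * K * jnorm x ^ (-α) := by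
    have hG : Summable (sᶜ.indicator fun y => A * 2 ^ α * jnorm x ^ (-α) * |g (x - y)|) :=
      (hgx.mul_left _).indicator _
    refine (abs_tsum_indicator_le hFs hG fun y hy => ?_).trans ?_
    · have hy' : euclidNorm x / 2 < euclidNorm y := not_le.1 hy
      have hxy : jnorm x ≤ 2 * jnorm y := jnorm_le_mul_jnorm (by norm_num) (by linarith)
      have h1 := jnorm_rpow_neg_le_of_jnorm_le (by norm_num) hα0.le hxy
      rw [hF_def, abs_mul]
      calc |f y| * |g (x - y)| ≤ (A * jnorm y ^ (-α)) * |g (x - y)| :=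
            mul_le_mul_of_nonneg_right (hf y) (abs_nonneg _)
        _ ≤ (A * (2 ^ α * jnorm x ^ (-α))) * |g (x - y)| :=
            mul_le_mul_of_nonneg_right (mul_le_mul_of_nonneg_left h1 hA) (abs_nonneg _)
        _ = A * 2 ^ α * jnorm x ^ (-α) * |g (x - y)| := by ring
    · calc ∑' y, sᶜ.indicator (fun y => A * 2 ^ α * jnorm x ^ (-α) * |g (x - y)|) y
          ≤ ∑' y, A * 2 ^ α * jnorm x ^ (-α) * |g (x - y)| :=
            Summable.tsum_le_tsum (fun y => Set.indicator_le_self' (fun _ _ =>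
              mul_nonneg (mul_nonneg (by positivity) (Real.rpow_nonneg hx.le _)) (abs_nonneg _)) y) hG (hgx.mul_left _)
        _ = A * 2 ^ α * jnorm x ^ (-α) * ∑' y, |g y| := by
            rw [tsum_mul_left, tsum_comp_sub_left (fun y => |g y|) x]
        _ ≤ A * 2 ^ α * jnorm x ^ (-α) * K :=
            mul_le_mul_of_nonneg_left hgK (mul_nonneg (by positivity) (Real.rpow_nonneg hx.le _))
        _ = 2 ^ α * A * K * jnorm x ^ (-α) := by ring
  calc |∑' y, s.indicator F y + ∑' y, sᶜ.indicator F y|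
      ≤ |∑' y, s.indicator F y| + |∑' y, sᶜ.indicator F y| := abs_add_le _ _
    _ ≤ 2 ^ (d : ℝ) * Cb * A * K * jnorm x ^ (-α) + 2 ^ α * A * K * jnorm x ^ (-α) := add_le_add hT₁ hT₂
    _ = (2 ^ (d : ℝ) * Cb + 2 ^ α) * A * K * jnorm x ^ (-α) := by ring


/-! ### Hara's Lemma B.1 (i), case `α > d > β` -/

/-- A function with `|f y| ≤ A ⟦y⟧^{-a}`, `a ≥ 0`, is bounded by `A`. [folklore] -/
theorem abs_le_of_decay {f : Site d → ℝ} {A a : ℝ} (hf : ∀ y, |f y| ≤ A * jnorm y ^ (-a)) (ha : 0 ≤ a)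
    (y : Site d) : |f y| ≤ A :=
  (hf y).trans (mul_le_of_le_one_right (nonneg_of_decay hf)
    (Real.rpow_le_one_of_one_le_of_nonpos (one_le_jnorm y) (by linarith)))

/-- **Hara 2008, Lemma B.1 (i)** (= Hara–van der Hofstad–Slade 2003, Prop. 1.7 (i)), in the case
`α > d > β ≥ 0`: there is `C = C(α, β, d)` such that `|f(x)| ≤ A⟦x⟧^{-α}`, `|g(x)| ≤ B⟦x⟧^{-β}`
imply `|(f*g)(x)| ≤ C A B ⟦x⟧^{-β}` (`= ⟦x⟧^{-(α ∧ β)}`; split the sum at `|y| = |x|/2`).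
[cite: Hara2008, Lemma B.1 (i)] [cite: HaraHofstadSlade2003, Prop. 1.7 (i) and its proof (§5)] -/
theorem exists_convolution_bound_i (hd : 1 ≤ d) {a b : ℝ} (ha : (d : ℝ) < a) (hb0 : 0 ≤ b) (hbd : b < d) :
    ∃ C : ℝ, 0 ≤ C ∧ ∀ (f g : Site d → ℝ) (A B : ℝ), (∀ y, |f y| ≤ A * jnorm y ^ (-a)) →
      (∀ y, |g y| ≤ B * jnorm y ^ (-b)) → ∀ x, |∑' y, f (x - y) * g y| ≤ C * A * B * jnorm x ^ (-b) := by
  obtain ⟨Cb, hCb, hball⟩ := exists_tsum_ball_jnorm_rpow_neg_le hd hb0 hbd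
  have hsum := summable_jnorm_rpow_neg ha
  set Ct := ∑' z : Site d, jnorm z ^ (-a) with hCt
  have hCt0 : 0 ≤ Ct := tsum_nonneg fun z => Real.rpow_nonneg (jnorm_pos z).le _
  have ha0 : 0 ≤ a := (Nat.cast_nonneg d).trans ha.le
  refine ⟨2 ^ a * Cb + 2 ^ b * Ct, by positivity, fun f g A B hf hg x => ?_⟩
  have hA : 0 ≤ A := nonneg_of_decay hf
  have hB : 0 ≤ B := nonneg_of_decay hg
  have hx := jnorm_pos x
  set F : Site d → ℝ := fun y => f (x - y) * g y with hF_def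
  have hfx : Summable fun y => jnorm (x - y) ^ (-a) := summable_comp_sub_left hsum x
  have hFs : Summable F := by
    refine Summable.of_norm_bounded (hfx.mul_left (A * B)) fun y => ?_
    rw [Real.norm_eq_abs, hF_def, abs_mul]
    calc |f (x - y)| * |g y| ≤ (A * jnorm (x - y) ^ (-a)) * B :=
          mul_le_mul (hf _) (abs_le_of_decay hg hb0 y) (abs_nonneg _) (mul_nonneg hA (Real.rpow_nonneg (jnorm_pos _).le _))
      _ = A * B * jnorm (x - y) ^ (-a) := by ring
  set s : Set (Site d) := {y | euclidNorm y ≤ euclidNorm x / 2} with hs_def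
  rw [tsum_eq_tsum_indicator_add_compl hFs s]
  -- inner region `|y| ≤ |x|/2`: `⟦x - y⟧ ≥ ⟦x⟧/2`
  have hT₁ : |∑' y, s.indicator F y| ≤ 2 ^ a * Cb * A * B * jnorm x ^ (-b) := by
    have hG : Summable (s.indicator fun y => A * B * 2 ^ a * jnorm x ^ (-a) * jnorm y ^ (-b)) :=
      summable_indicator_ball _ _
    refine (abs_tsum_indicator_le hFs hG fun y hy => ?_).trans ?_
    · have hy' : euclidNorm y ≤ euclidNorm x / 2 := hy
      have hxy : jnorm x ≤ 2 * jnorm (x - y) :=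
        jnorm_le_mul_jnorm (by norm_num) (by linarith [euclidNorm_le_sub_add x y])
      have h1 := jnorm_rpow_neg_le_of_jnorm_le (by norm_num) ha0 hxy
      have hBy : 0 ≤ B * jnorm y ^ (-b) := mul_nonneg hB (Real.rpow_nonneg (jnorm_pos y).le _)
      rw [hF_def, abs_mul]
      calc |f (x - y)| * |g y| ≤ (A * jnorm (x - y) ^ (-a)) * (B * jnorm y ^ (-b)) :=
            mul_le_mul (hf _) (hg y) (abs_nonneg _) (mul_nonneg hA (Real.rpow_nonneg (jnorm_pos _).le _))
        _ ≤ (A * (2 ^ a * jnorm x ^ (-a))) * (B * jnorm y ^ (-b)) :=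
            mul_le_mul_of_nonneg_right (mul_le_mul_of_nonneg_left h1 hA) hBy
        _ = A * B * 2 ^ a * jnorm x ^ (-a) * jnorm y ^ (-b) := by ring
    · have e : (s.indicator fun y => A * B * 2 ^ a * jnorm x ^ (-a) * jnorm y ^ (-b)) =
          fun y => A * B * 2 ^ a * jnorm x ^ (-a) * s.indicator (fun y => jnorm y ^ (-b)) y := by
        funext y
        exact Set.indicator_mul_right s (fun _ => A * B * 2 ^ a * jnorm x ^ (-a)) _
      rw [e, tsum_mul_left]
      have h2 := hball (euclidNorm x / 2)
      have h3 : (max (euclidNorm x / 2) 1) ^ ((d : ℝ) - b) ≤ jnorm x ^ ((d : ℝ) - b) :=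
        max_div_one_rpow_le x (by norm_num) (by linarith)
      have h4 : jnorm x ^ (-a) * jnorm x ^ ((d : ℝ) - b) ≤ jnorm x ^ (-b) := by
        rw [jnorm_rpow_mul_rpow]
        exact jnorm_rpow_le_rpow_of_le x (by linarith)
      calc A * B * 2 ^ a * jnorm x ^ (-a) * ∑' y, s.indicator (fun y => jnorm y ^ (-b)) y
          ≤ A * B * 2 ^ a * jnorm x ^ (-a) * (Cb * jnorm x ^ ((d : ℝ) - b)) :=
            mul_le_mul_of_nonneg_left (h2.trans (mul_le_mul_of_nonneg_left h3 hCb))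
              (mul_nonneg (by positivity) (Real.rpow_nonneg hx.le _))
        _ = 2 ^ a * Cb * A * B * (jnorm x ^ (-a) * jnorm x ^ ((d : ℝ) - b)) := by ring
        _ ≤ 2 ^ a * Cb * A * B * jnorm x ^ (-b) := mul_le_mul_of_nonneg_left h4 (by positivity)
  -- outer region `|y| > |x|/2`: `⟦y⟧ ≥ ⟦x⟧/2`
  have hT₂ : |∑' y, sᶜ.indicator F y| ≤ 2 ^ b * Ct * A * B * jnorm x ^ (-b) := by
    have hG : Summable (sᶜ.indicator fun y => B * 2 ^ b * jnorm x ^ (-b) * (A * jnorm (x - y) ^ (-a))) :=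
      ((hfx.mul_left A).mul_left _).indicator _
    refine (abs_tsum_indicator_le hFs hG fun y hy => ?_).trans ?_
    · have hy' : euclidNorm x / 2 < euclidNorm y := not_le.1 hy
      have hxy : jnorm x ≤ 2 * jnorm y := jnorm_le_mul_jnorm (by norm_num) (by linarith)
      have h1 := jnorm_rpow_neg_le_of_jnorm_le (by norm_num) hb0 hxy
      rw [hF_def, abs_mul, mul_comm]
      calc |g y| * |f (x - y)| ≤ (B * jnorm y ^ (-b)) * (A * jnorm (x - y) ^ (-a)) :=
            mul_le_mul (hg y) (hf _) (abs_nonneg _) (mul_nonneg hB (Real.rpow_nonneg (jnorm_pos _).le _))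
        _ ≤ (B * (2 ^ b * jnorm x ^ (-b))) * (A * jnorm (x - y) ^ (-a)) :=
            mul_le_mul_of_nonneg_right (mul_le_mul_of_nonneg_left h1 hB)
              (mul_nonneg hA (Real.rpow_nonneg (jnorm_pos _).le _))
        _ = B * 2 ^ b * jnorm x ^ (-b) * (A * jnorm (x - y) ^ (-a)) := by ring
    · have hnn : ∀ y, 0 ≤ B * 2 ^ b * jnorm x ^ (-b) * (A * jnorm (x - y) ^ (-a)) := fun y =>
        mul_nonneg (mul_nonneg (by positivity) (Real.rpow_nonneg hx.le _)) (mul_nonneg hA (Real.rpow_nonneg (jnorm_pos _).le _))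
      calc ∑' y, sᶜ.indicator (fun y => B * 2 ^ b * jnorm x ^ (-b) * (A * jnorm (x - y) ^ (-a))) y
          ≤ ∑' y, B * 2 ^ b * jnorm x ^ (-b) * (A * jnorm (x - y) ^ (-a)) :=
            Summable.tsum_le_tsum (fun y => Set.indicator_le_self' (fun _ _ => hnn y) y) hG ((hfx.mul_left A).mul_left _)
        _ = B * 2 ^ b * jnorm x ^ (-b) * (A * Ct) := by
            rw [tsum_mul_left, tsum_mul_left, tsum_comp_sub_left (fun y => jnorm y ^ (-a)) x]
        _ = 2 ^ b * Ct * A * B * jnorm x ^ (-b) := by ring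
  calc |∑' y, s.indicator F y + ∑' y, sᶜ.indicator F y|
      ≤ |∑' y, s.indicator F y| + |∑' y, sᶜ.indicator F y| := abs_add_le _ _
    _ ≤ 2 ^ a * Cb * A * B * jnorm x ^ (-b) + 2 ^ b * Ct * A * B * jnorm x ^ (-b) := add_le_add hT₁ hT₂
    _ = (2 ^ a * Cb + 2 ^ b * Ct) * A * B * jnorm x ^ (-b) := by ring



end Literature.Barriers.CriticalPhenomena
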